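import Summits.CriticalPhenomena.Ising3DConformalLimit.Theorems.SynchronousCouplingUniformRegularityMagneticRulerTransfer
import Summits.CriticalPhenomena.Ising3DConformalLimit.Theorems.LeeYangGapNearCriticalLeeYangGapSusceptibilityDoubling
import Literature.Probability.LatticeModels.SharpnessProofs
import Literature.Probability.LatticeModels.ThermodynamicLimit
import HarnessLib

/-!
# Route SynchronousCoupling · crux `UniformRegularity` (stmt-CriticalPhenomena-4658) ·
# line `Sketch` (magnetic ruler) · stub `stub_magneticScaleUpper`

By-product (U) of the magnetic-ruler line: the **pointwise Buckingham–Gunton inequality** on `ℤ³`.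
With `M(h) := ⟨σ₀⟩⁺_{β_c,h}` (`magnetizationInField 3 (criticalBeta 3) h`), `g(x) := ⟨σ₀σ_x⟩⁺_{β_c,0}`
(`criticalTwoPoint 3 x`) and `S_h(x) := ⟨σ₀σ_x⟩⁺_{β_c,h}` (`plusCorr 3 (criticalBeta 3) h {0, x}`),
the zero-field critical two-point function can exceed `2 M(h)²` only INSIDE the magnetic length
`ℓ_h ≍ (h M(h))^{-1/3}`: there is `C > 0` (here `C = 7/β_c(3)`) such that for `h > 0` and `n : ℕ`,

  `C ≤ n³ · h · M(h)  ⟹  g(n e₀) < 2 M(h)²`.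

**Proof.** Suppose `2 M² ≤ g(n e₀)`.
* `n ≥ 3`: put `m := ⌊n/3⌋ ≥ 1` and `Λ := Λ_m ∖ {0}` (`(box 3 m).erase 0`). For `x ∈ Λ`,
  `3‖x‖_∞ ≤ 3m ≤ n`, so Messager–Miracle-Solé (landed
  `LeeYangGapNearCriticalLeeYangGap.criticalTwoPoint_axis_le`, ADC21 (5.3)) gives
  `g(n e₀) ≤ g(x)`, and GKS in the field (landed `stub_fieldMonotone`) gives `g(x) ≤ S_h(x)`;
  hence every term of the anchored GHS sum rule (landed `stub_truncatedSumRule`)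
  `β_c h Σ_{x∈Λ} (S_h(x) − M²) ≤ M` is at least `M²`, so `β_c h |Λ| M ≤ 1` (`M > 0`, landed
  `stub_magnetizationRegular`). As `|Λ| = (2m+1)³ − 1` and `n ≤ 3m + 2`, `n³ ≤ 6 |Λ|`, whence
  `β_c n³ h M ≤ 6 < 7`.
* `1 ≤ n ≤ 2`: the axis terms `S_h(k e₀) − M²`, `1 ≤ k ≤ n`, are `≥ M²` (axis antitonicity of `g`
  and `stub_fieldMonotone`), so the landed window lemma `window_of_sumRule` gives `β_c n h M ≤ 1`,
  whence `β_c n³ h M ≤ 4 < 7`.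
* `n = 0`: the hypothesis reads `C ≤ 0`.

References: Fernández–Fröhlich–Sokal 1992, §14.3.5 (Buckingham–Gunton)
[FernandezFrohlichSokal1992]; Aizenman–Duminil-Copin 2021, §5.1 eq. (5.3)
[AizenmanDuminilCopinAnnals2021]; Lebowitz 1974 [Lebowitz1974].
-/

noncomputable section

namespace Summit.CriticalPhenomena.Ising3DConformalLimit.Theorems.MagneticRuler

open scoped BigOperators
open Finset
open Literature.Probability.LatticeModels
open Summit.CriticalPhenomena.Ising3DConformalLimit.LeeYangGapNearCriticalLeeYangGap
  (criticalTwoPoint_axis_le)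

/- Messager–Miracle-Solé at `β_c` on `ℤ³` in the axis form `g(s e₀) ≤ g(x)` for `3‖x‖_∞ ≤ s`
is the landed `LeeYangGapNearCriticalLeeYangGap.criticalTwoPoint_axis_le` (reused, not restated). -/

/-- The punctured box `Λ_m ∖ {0}` has `(2m+1)³ − 1` sites: `|Λ_m ∖ {0}| + 1 = (2m+1)³` (as reals).
[folklore] -/
theorem card_box_erase_zero_add_one (m : ℕ) :
    (#((box 3 m).erase 0) : ℝ) + 1 = (2 * (m : ℝ) + 1) ^ 3 := by
  have h0box : (0 : Site 3) ∈ box 3 m :=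
    mem_box_iff_supNorm_le.2 (by rw [Site.supNorm_eq_zero_iff.2 rfl]; exact Nat.zero_le _)
  have h := Finset.card_erase_add_one h0box
  rw [card_box] at h
  exact_mod_cast h

/-- Elementary volume count: for `m ≥ 1` and `0 ≤ n ≤ 3m + 2`, `n³ ≤ 6 ((2m+1)³ − 1)`. [folklore] -/
theorem cube_le_six_mul_card {m n : ℝ} (hm : 1 ≤ m) (hn0 : 0 ≤ n) (hn : n ≤ 3 * m + 2) :
    n ^ 3 ≤ 6 * ((2 * m + 1) ^ 3 - 1) := by
  have h1 : n ^ 3 ≤ (3 * m + 2) ^ 3 := by gcongr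
  have hm2 : 1 ≤ m ^ 2 := by nlinarith
  have hm3 : 1 ≤ m ^ 3 := by nlinarith
  nlinarith [h1, hm2, hm3]

/-- **Every term of the sum rule is at least `M²` inside `3‖x‖_∞ ≤ n` when `2M² ≤ g(n e₀)`**:
MMS (`g(n e₀) ≤ g(x)`, landed `LeeYangGapNearCriticalLeeYangGap.criticalTwoPoint_axis_le`) and GKS in
the field (`g(x) ≤ S_h(x)`, landed `stub_fieldMonotone`).
[cite: AizenmanDuminilCopinAnnals2021, §5.1 eq. (5.3)] -/
theorem sq_le_trunc_of_two_sq_le_axis {h : ℝ} (hh : 0 ≤ h) {n : ℕ}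
    (hge : 2 * (magnetizationInField 3 (criticalBeta 3) h) ^ 2 ≤
      criticalTwoPoint 3 (Pi.single 0 (n : ℤ)))
    {x : Site 3} (hx : x ≠ 0) (hxn : 3 * Site.supNorm x ≤ n) :
    (magnetizationInField 3 (criticalBeta 3) h) ^ 2 ≤
      plusCorr 3 (criticalBeta 3) h {0, x} - (magnetizationInField 3 (criticalBeta 3) h) ^ 2 := by
  have h1 := criticalTwoPoint_axis_le hxn
  have h2 := stub_fieldMonotone h hh x hx
  linarith

/-- **Stub `stub_magneticScaleUpper` of line `Sketch` (magnetic ruler, crux stmt-CriticalPhenomena-4658) —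
the pointwise Buckingham–Gunton inequality on `ℤ³`**: with `C = 7/β_c(3) > 0`, for every `h > 0` and
`n : ℕ`, if `C ≤ n³ h M(h)` then `g(n e₀) < 2 M(h)²`. For `n ≥ 3` the anchored GHS sum rule on the
punctured box `Λ_{⌊n/3⌋} ∖ {0}` (every term `≥ M²` by MMS and GKS) gives `β_c n³ h M ≤ 6`; for
`1 ≤ n ≤ 2` the axis window `{e₀, …, n e₀}` gives `β_c n³ h M ≤ 4`; `n = 0` is excluded by `C > 0`.
[cite: FernandezFrohlichSokal1992, §14.3.5] [cite: AizenmanDuminilCopinAnnals2021, §5.1 eq. (5.3)] -/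
theorem stub_magneticScaleUpper : ∃ C : ℝ, 0 < C ∧ ∀ h : ℝ, 0 < h → ∀ n : ℕ, C ≤ (n : ℝ) ^ 3 * h * Literature.Probability.LatticeModels.magnetizationInField 3 (Literature.Probability.LatticeModels.criticalBeta 3) h → Literature.Probability.LatticeModels.criticalTwoPoint 3 (Pi.single 0 (n : ℤ)) < 2 * (Literature.Probability.LatticeModels.magnetizationInField 3 (Literature.Probability.LatticeModels.criticalBeta 3) h) ^ 2 := by
  have hβ : 0 < criticalBeta 3 := criticalBeta_pos_holds (d := 3) (by norm_num)
  refine ⟨7 / criticalBeta 3, by positivity, fun h hh n hC => ?_⟩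
  have hM : 0 < magnetizationInField 3 (criticalBeta 3) h := stub_magnetizationRegular.2.2 h hh
  set M := magnetizationInField 3 (criticalBeta 3) h with hMdef
  rw [div_le_iff₀ hβ] at hC
  by_contra hge
  rw [not_lt] at hge
  rcases Nat.lt_or_ge n 3 with hn3 | hn3
  · -- small scales `n ≤ 2`
    rcases Nat.eq_zero_or_pos n with rfl | hn1
    · norm_num at hC
    · -- the axis window `{e₀, …, n e₀}`: every term is `≥ M²`
      have hwin : criticalBeta 3 * ((n : ℝ) * h * M) ≤ 1 := by
        refine window_of_sumRule hh hM fun k hk1 hkn => ?_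
        have hk0 : (Pi.single 0 (k : ℤ) : Site 3) ≠ 0 :=
          single_axis_ne_zero (by exact_mod_cast (by omega : k ≠ 0))
        have hanti : criticalTwoPoint 3 (Pi.single 0 (n : ℤ)) ≤
            criticalTwoPoint 3 (Pi.single 0 (k : ℤ)) := criticalTwoPoint_axis_antitone hkn
        have hfield := stub_fieldMonotone h hh.le _ hk0
        linarith
      have hn2 : (n : ℝ) ≤ 2 := by exact_mod_cast (by omega : n ≤ 2)
      have hn0 : (0 : ℝ) ≤ n := Nat.cast_nonneg n
      have hnhM : 0 ≤ (n : ℝ) * h * M := by positivity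
      have hcube : (n : ℝ) ^ 3 * h * M ≤ 4 * ((n : ℝ) * h * M) := by
        have hsq : (n : ℝ) ^ 2 ≤ 4 := by nlinarith
        calc (n : ℝ) ^ 3 * h * M = (n : ℝ) ^ 2 * ((n : ℝ) * h * M) := by ring
          _ ≤ 4 * ((n : ℝ) * h * M) := mul_le_mul_of_nonneg_right hsq hnhM
      have h4 : criticalBeta 3 * ((n : ℝ) ^ 3 * h * M) ≤ criticalBeta 3 * (4 * ((n : ℝ) * h * M)) :=
        mul_le_mul_of_nonneg_left hcube hβ.le
      nlinarith [hwin, h4, hC]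
  · -- scales `n ≥ 3`: the punctured box `Λ_m ∖ {0}`, `m = ⌊n/3⌋ ≥ 1`
    set m : ℕ := n / 3 with hm
    have hm1 : 1 ≤ m := by omega
    have hnm : n ≤ 3 * m + 2 := by omega
    set Λ : Finset (Site 3) := (box 3 m).erase 0 with hΛ
    have h0Λ : (0 : Site 3) ∉ Λ := Finset.notMem_erase 0 _
    have hsum := stub_truncatedSumRule h hh Λ h0Λ
    -- the sum over `Λ` is at least `|Λ| M²`
    have hlow : (#Λ : ℝ) * M ^ 2 ≤ ∑ x ∈ Λ, (plusCorr 3 (criticalBeta 3) h {0, x} - M ^ 2) := by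
      have hconst : ∑ _x ∈ Λ, M ^ 2 = (#Λ : ℝ) * M ^ 2 := by
        rw [Finset.sum_const, nsmul_eq_mul]
      rw [← hconst]
      refine Finset.sum_le_sum fun x hx => ?_
      obtain ⟨hx0, hxbox⟩ := Finset.mem_erase.1 hx
      have hxm : Site.supNorm x ≤ m := mem_box_iff_supNorm_le.1 hxbox
      exact sq_le_trunc_of_two_sq_le_axis hh.le hge hx0 (by omega)
    -- `n³ ≤ 6 |Λ|`
    have hcard : (#Λ : ℝ) + 1 = (2 * (m : ℝ) + 1) ^ 3 := card_box_erase_zero_add_one m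
    have hn3Λ : (n : ℝ) ^ 3 ≤ 6 * (#Λ : ℝ) := by
      have hmR : (1 : ℝ) ≤ m := by exact_mod_cast hm1
      have hnR : (n : ℝ) ≤ 3 * m + 2 := by exact_mod_cast hnm
      have := cube_le_six_mul_card hmR (Nat.cast_nonneg n) hnR
      linarith [hcard]
    -- `β_c h |Λ| M² ≤ M`, hence `β_c h |Λ| M ≤ 1`
    have h1 : criticalBeta 3 * h * ((#Λ : ℝ) * M ^ 2) ≤ M :=
      le_trans (mul_le_mul_of_nonneg_left hlow (mul_nonneg hβ.le hh.le)) hsum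
    have h2 : criticalBeta 3 * h * (#Λ : ℝ) * M ≤ 1 := by
      have h2' : criticalBeta 3 * h * (#Λ : ℝ) * M * M ≤ 1 * M := by nlinarith [h1]
      exact le_of_mul_le_mul_right h2' hM
    -- `β_c n³ h M ≤ 6 β_c h |Λ| M ≤ 6 < 7 ≤ β_c n³ h M`
    have h3 : criticalBeta 3 * h * M * (n : ℝ) ^ 3 ≤ criticalBeta 3 * h * M * (6 * (#Λ : ℝ)) :=
      mul_le_mul_of_nonneg_left hn3Λ (by positivity)
    nlinarith [h2, h3, hC]

end Summit.CriticalPhenomena.Ising3DConformalLimit.Theorems.MagneticRuler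

end
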